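import Summits.AtomisticToContinuum.HydrodynamicLimit.Theses.JParityClosure
import Summits.AtomisticToContinuum.HydrodynamicLimit.Theses.InformationPercolationEngine

/-!
# Crux `LocalSecondLaw` (stmt-AtomisticToContinuum-13081) — strategy census gen 1 (seat p1), kernel-checked part

Crux-strategist seat `planner-cstrat-stmt-AtomisticToContinuum-13081-p1-0` (2026-08-17, wall-breaker on the exhausted chain).
Companion of `Cruxes/LocalSecondLaw/STRATEGY-CENSUS.md` (gen 1).  Imports only the two route files.  Contents:

* §D6 — the QUARANTINE SPLIT, typed: `LocalSecondLawInBand` (C′, byte-copy of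
  `Cruxes/LocalSecondLaw/Restatement.lean :: LocalSecondLawInBand`, c4) and `BeyondBand := C′ → C`; the split glue
  `localSecondLaw_of_inBand_of_beyondBand : C′ → BeyondBand → C` (modus ponens) and the two comparison lemmas
  `localSecondLawInBand_of_localSecondLaw : C → C′`, `beyondBand_of_localSecondLaw : C → BeyondBand` (both pieces are
  implied by the crux; the second piece carries the whole post-classical excess — census §D6 explains why it is NOT filed).
* §S7 — the CLAMPED restatement candidate `LocalSecondLawInBandClamped` (C′ with the Březina–Feireisl bounded
  renormalisation `s ↦ max lo (min s hi)` of the specific entropy, for every `lo < hi`, cf. the typing of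
  `Theses.BoxDissipativeWeakStrong.EntropyAdmissibility`, stmt-9903): recorded because census §N5 shows the UNclamped
  functional has a typicality-blind cold-pair window at every horizon (pre-shock included); the clamp removes it
  (`|ρ·clamp(s)| ≤ ρ·max |lo| |hi|`).  Only elaboration is claimed for it.

No `sorry`; standard axioms.
-/

namespace Summit.AtomisticToContinuum.HydrodynamicLimit.Cruxes.LocalSecondLaw.StrategyCensusP1

open Summit.AtomisticToContinuum.HydrodynamicLimit.Theses

/-! ## §D6 — the quarantine split `C ⟸ C′ ∧ (C′ → C)` -/

/-- **C′ — `LocalSecondLaw` before the first shock, inside the packing band** (byte-copy of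
`Restatement.LocalSecondLawInBand`, c4; the text 14 seats ask the item to be restated to). -/
def LocalSecondLawInBand : Prop :=
  ∃ η₀ : ℝ, 0 < η₀ ∧ ∀ (a₀ θ₀ : Literature.MathematicalPhysics.KineticTheory.T3 → ℝ) (u₀ : Literature.MathematicalPhysics.KineticTheory.T3 → Literature.MathematicalPhysics.KineticTheory.V3), Continuous a₀ → Continuous θ₀ → Continuous u₀ → (∀ x, 0 < a₀ x) → (∀ x, 0 < θ₀ x) → ∃ σ₀ : ℝ, 0 < σ₀ ∧ ∀ σ : ℝ, 0 < σ → σ < σ₀ → ∀ (T : ℝ) (ρ θ : ℝ → Literature.MathematicalPhysics.KineticTheory.T3 → ℝ) (u : ℝ → Literature.MathematicalPhysics.KineticTheory.T3 → Literature.MathematicalPhysics.KineticTheory.V3), Literature.MathematicalPhysics.KineticTheory.IsHardSphereEulerSolution σ T ρ u θ → (∀ t ∈ Set.Ico 0 T, ∀ x, ρ t x * σ ^ 3 < η₀) → ∀ Φ : (N : ℕ) → Literature.Analysis.FluidPDE.HardSphereFlow (Literature.Analysis.FluidPDE.Torus.geometry (Fin 3)) (Literature.MathematicalPhysics.KineticTheory.hsDiameter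 σ N) (N + 1), Literature.MathematicalPhysics.KineticTheory.TendstoHydroFieldsAt (fun N => Literature.MathematicalPhysics.KineticTheory.localGibbsLaw σ a₀ u₀ θ₀ N (Φ N)) Φ ρ u θ 0 → 0 < T → ∀ τ : ℝ, 0 < τ → τ < T → ∀ φ : ℝ → Literature.MathematicalPhysics.KineticTheory.T3 → ℝ, Literature.Analysis.FunctionSpaces.Torus.IsSmoothSpaceTimeOn Set.univ φ → (∀ s x, 0 ≤ φ s x) → (∃ τ' : ℝ, τ' < τ ∧ ∀ s, τ' ≤ s → ∀ x, φ s x = 0) → ∀ η δ : ℝ, 0 < η → 0 < δ → ∃ r₀ : ℝ, 0 < r₀ ∧ ∀ r : ℝ, 0 < r → r < r₀ → ∃ N₀ : ℕ, ∀ N : ℕ, N₀ ≤ N → let γ : Literature.Analysis.FluidPDE.Config (N + 1) (Fin 3) Literature.MathematicalPhysics.KineticTheory.T3 → ℝ → Literature.Analysis.FluidPDE.Config (N + 1) (Fin 3) Literature.MathematicalPhysics.KineticTheory.T3 := fun z s => (Φ N).flow s z; let bx : Literature.MathematicalPhysics.KineticTheory.T3 → Literature.MathematicalPhysics.KineticTheory.T3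 → ℝ := fun x y => 3 / (Real.pi * r ^ 3) * max (1 - Literature.Analysis.FluidPDE.Torus.euclidDist x y / r) 0; let ρm : Literature.Analysis.FluidPDE.Config (N + 1) (Fin 3) Literature.MathematicalPhysics.KineticTheory.T3 → ℝ → Literature.MathematicalPhysics.KineticTheory.T3 → ℝ := fun z s x₀ => ∫ q, bx q.1 x₀ ∂(Literature.Analysis.FluidPDE.empiricalMeasure (γ z s)); let mm : Literature.Analysis.FluidPDE.Config (N + 1) (Fin 3) Literature.MathematicalPhysics.KineticTheory.T3 → ℝ → Literature.MathematicalPhysics.KineticTheory.T3 → Literature.MathematicalPhysics.KineticTheory.V3 := fun z s x₀ => ∫ q, bx q.1 x₀ • q.2 ∂(Literature.Analysis.FluidPDE.empiricalMeasure (γ z s)); let em : Literature.Analysis.FluidPDE.Config (N + 1) (Fin 3) Literature.MathematicalPhysics.KineticTheory.T3 → ℝ → Literature.MathematicalPhysics.KineticTheory.T3 → ℝ := fun z s x₀ => ∫ q, bx q.1 x₀ * (‖q.2‖ ^ 2 / 2) ∂(Literature.Analysis.FluidPDE.empiricalMeasure (γ z s)); let θm : Literature.Analysis.FluidPDE.Config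 (N + 1) (Fin 3) Literature.MathematicalPhysics.KineticTheory.T3 → ℝ → Literature.MathematicalPhysics.KineticTheory.T3 → ℝ := fun z s x₀ => 2 / 3 * (em z s x₀ / ρm z s x₀ - ‖mm z s x₀‖ ^ 2 / (2 * ρm z s x₀ ^ 2)); let Hs : ℝ → ℝ → ℝ := fun a b => if 0 < a ∧ 0 < b then -(a * (3 / 2 * Real.log b - Real.log a - Literature.MathematicalPhysics.KineticTheory.hsExcessFreeEnergy (a * σ ^ 3))) else 0; let I : Literature.Analysis.FluidPDE.Config (N + 1) (Fin 3) Literature.MathematicalPhysics.KineticTheory.T3 → ℝ := fun z => ∫ s in Set.Icc (0 : ℝ) τ, ∫ x : Literature.MathematicalPhysics.KineticTheory.T3, Hs (ρm z s x) (θm z s x) * (deriv (fun s' => φ s' x) s + ∑ k : Fin 3, (mm z s x) k / ρm z s x * Literature.Analysis.FunctionSpaces.Torus.partialDeriv k (φ s) x); Literature.MathematicalPhysics.KineticTheory.localGibbsLaw σ a₀ u₀ θ₀ N (Φ N) {z | I z + ∫ x : Literature.MathematicalPhysics.KineticTheory.T3, Hs (ρ 0 x) (θ 0 x) * φ 0 x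 < -η} ≤ ENNReal.ofReal δ

/-- **The excess of the typed crux over C′, as one statement** — the "beyond the band / beyond the classical horizon"
extension: local Clausius–Duhem at horizons past the guarded classical lifespan.  Implied by the crux (below); carries the
crux's ENTIRE post-classical content (census §0, §D6); no producer on the board or in print. -/
def BeyondBand : Prop :=
  LocalSecondLawInBand → InformationPercolationEngine.LocalSecondLaw

/-- Split glue (D6): `C′ → (C′ → C) → C` — modus ponens. -/
theorem localSecondLaw_of_inBand_of_beyondBand (h₁ : LocalSecondLawInBand) (h₂ : BeyondBand) :
    InformationPercolationEngine.LocalSecondLaw :=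
  h₂ h₁

/-- The crux implies its first piece C′ (drop `τ < T` and the guard; witness `η₀ := 1`) — twin of
`Restatement.localSecondLawInBand_of_localSecondLaw` over the IPE copy of the decl. -/
theorem localSecondLawInBand_of_localSecondLaw (h : InformationPercolationEngine.LocalSecondLaw) :
    LocalSecondLawInBand := by
  refine ⟨1, one_pos, ?_⟩
  intro a₀ θ₀ u₀ ha hθ hu ha0 hθ0
  obtain ⟨σ₀, hσ₀, H⟩ := h a₀ θ₀ u₀ ha hθ hu ha0 hθ0
  refine ⟨σ₀, hσ₀, fun σ hσ hσ' T ρ θ u hE _hband Φ h0 hT τ hτ _hτT => ?_⟩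
  exact H σ hσ hσ' T ρ θ u hE Φ h0 hT τ hτ

/-- The crux implies its second piece (trivially: `C → (C′ → C)`), so `BeyondBand` is logically no stronger than the crux;
what it is NOT is weaker in difficulty — see census §0 (irreducibility) and §D6. -/
theorem beyondBand_of_localSecondLaw (h : InformationPercolationEngine.LocalSecondLaw) : BeyondBand :=
  fun _ => h

/-- The two route copies of the crux are one proposition (shared item), so everything here applies to the JParityClosure
copy verbatim. -/
theorem jParity_iff_ipe : JParityClosure.LocalSecondLaw ↔ InformationPercolationEngine.LocalSecondLaw := Iff.rfl

/-! ## §S7 — the clamped (Březina–Feireisl renormalised) restatement candidate -/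

/-- **C′_clamp — C′ with the bounded renormalisation of the specific entropy.**  Verbatim `LocalSecondLawInBand` except:
`∀ lo hi : ℝ, lo < hi →` is inserted before `∀ η δ`, and the entropy density reads
`Hs ρ θ := -(ρ * max lo (min s hi))` with `s = 3/2 log θ − log ρ − f_ex(ρσ³)` (guarded to `0` off `{ρ, θ > 0}` as before),
both in the space–time functional and in the `t = 0` term.  This is the `Z_{lo,hi}` family of BrezinaFeireisl2018 Def. 2.9 /
§3.2 (the typing already used by `BoxDissipativeWeakStrong.EntropyAdmissibility`, stmt-9903); each instance has
`|Hs| ≤ ρ · max |lo| |hi|`, so ultra-cold sparse pairs (census §N5) and the EOS junk branch (census N2) contribute nothing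
beyond `O(1/N)` resp. nothing.  Recorded as an OPTION for the restating planner; neither implied by nor implying C′ by logic alone. -/
def LocalSecondLawInBandClamped : Prop :=
  ∃ η₀ : ℝ, 0 < η₀ ∧ ∀ (a₀ θ₀ : Literature.MathematicalPhysics.KineticTheory.T3 → ℝ) (u₀ : Literature.MathematicalPhysics.KineticTheory.T3 → Literature.MathematicalPhysics.KineticTheory.V3), Continuous a₀ → Continuous θ₀ → Continuous u₀ → (∀ x, 0 < a₀ x) → (∀ x, 0 < θ₀ x) → ∃ σ₀ : ℝ, 0 < σ₀ ∧ ∀ σ : ℝ, 0 < σ → σ < σ₀ → ∀ (T : ℝ) (ρ θ : ℝ → Literature.MathematicalPhysics.KineticTheory.T3 → ℝ) (u : ℝ → Literature.MathematicalPhysics.KineticTheory.T3 → Literature.MathematicalPhysics.KineticTheory.V3), Literature.MathematicalPhysics.KineticTheory.IsHardSphereEulerSolution σ T ρ u θ → (∀ t ∈ Set.Ico 0 T, ∀ x, ρ t x * σ ^ 3 < η₀) → ∀ Φ : (N : ℕ) → Literature.Analysis.FluidPDE.HardSphereFlow (Literature.Analysis.FluidPDE.Torus.geometry (Fin 3)) (Literature.MathematicalPhysics.KineticTheory.hsDiameter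 σ N) (N + 1), Literature.MathematicalPhysics.KineticTheory.TendstoHydroFieldsAt (fun N => Literature.MathematicalPhysics.KineticTheory.localGibbsLaw σ a₀ u₀ θ₀ N (Φ N)) Φ ρ u θ 0 → 0 < T → ∀ τ : ℝ, 0 < τ → τ < T → ∀ φ : ℝ → Literature.MathematicalPhysics.KineticTheory.T3 → ℝ, Literature.Analysis.FunctionSpaces.Torus.IsSmoothSpaceTimeOn Set.univ φ → (∀ s x, 0 ≤ φ s x) → (∃ τ' : ℝ, τ' < τ ∧ ∀ s, τ' ≤ s → ∀ x, φ s x = 0) → ∀ lo hi : ℝ, lo < hi → ∀ η δ : ℝ, 0 < η → 0 < δ → ∃ r₀ : ℝ, 0 < r₀ ∧ ∀ r : ℝ, 0 < r → r < r₀ → ∃ N₀ : ℕ, ∀ N : ℕ, N₀ ≤ N → let γ : Literature.Analysis.FluidPDE.Config (N + 1) (Fin 3) Literature.MathematicalPhysics.KineticTheory.T3 → ℝ → Literature.Analysis.FluidPDE.Config (N + 1) (Fin 3) Literature.MathematicalPhysics.KineticTheory.T3 := fun z s => (Φ N).flow s z; let bx : Literature.MathematicalPhysics.KineticTheory.T3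 → Literature.MathematicalPhysics.KineticTheory.T3 → ℝ := fun x y => 3 / (Real.pi * r ^ 3) * max (1 - Literature.Analysis.FluidPDE.Torus.euclidDist x y / r) 0; let ρm : Literature.Analysis.FluidPDE.Config (N + 1) (Fin 3) Literature.MathematicalPhysics.KineticTheory.T3 → ℝ → Literature.MathematicalPhysics.KineticTheory.T3 → ℝ := fun z s x₀ => ∫ q, bx q.1 x₀ ∂(Literature.Analysis.FluidPDE.empiricalMeasure (γ z s)); let mm : Literature.Analysis.FluidPDE.Config (N + 1) (Fin 3) Literature.MathematicalPhysics.KineticTheory.T3 → ℝ → Literature.MathematicalPhysics.KineticTheory.T3 → Literature.MathematicalPhysics.KineticTheory.V3 := fun z s x₀ => ∫ q, bx q.1 x₀ • q.2 ∂(Literature.Analysis.FluidPDE.empiricalMeasure (γ z s)); let em : Literature.Analysis.FluidPDE.Config (N + 1) (Fin 3) Literature.MathematicalPhysics.KineticTheory.T3 → ℝ → Literature.MathematicalPhysics.KineticTheory.T3 → ℝ := fun z s x₀ => ∫ q, bx q.1 x₀ * (‖q.2‖ ^ 2 / 2) ∂(Literature.Analysis.FluidPDE.empiricalMeasure (γ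 z s)); let θm : Literature.Analysis.FluidPDE.Config (N + 1) (Fin 3) Literature.MathematicalPhysics.KineticTheory.T3 → ℝ → Literature.MathematicalPhysics.KineticTheory.T3 → ℝ := fun z s x₀ => 2 / 3 * (em z s x₀ / ρm z s x₀ - ‖mm z s x₀‖ ^ 2 / (2 * ρm z s x₀ ^ 2)); let Hs : ℝ → ℝ → ℝ := fun a b => if 0 < a ∧ 0 < b then -(a * max lo (min (3 / 2 * Real.log b - Real.log a - Literature.MathematicalPhysics.KineticTheory.hsExcessFreeEnergy (a * σ ^ 3)) hi)) else 0; let I : Literature.Analysis.FluidPDE.Config (N + 1) (Fin 3) Literature.MathematicalPhysics.KineticTheory.T3 → ℝ := fun z => ∫ s in Set.Icc (0 : ℝ) τ, ∫ x : Literature.MathematicalPhysics.KineticTheory.T3, Hs (ρm z s x) (θm z s x) * (deriv (fun s' => φ s' x) s + ∑ k : Fin 3, (mm z s x) k / ρm z s x * Literature.Analysis.FunctionSpaces.Torus.partialDeriv k (φ s) x); Literature.MathematicalPhysics.KineticTheory.localGibbsLaw σ a₀ u₀ θ₀ N (Φ N) {z | I z + ∫ x : Literature.MathematicalPhysics.KineticTheory.T3,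 Hs (ρ 0 x) (θ 0 x) * φ 0 x < -η} ≤ ENNReal.ofReal δ

/-- Pointwise boundedness of the clamped entropy density: the property that removes the cold-pair window (census §N5).
Elementary: `|max lo (min s hi)| ≤ max |lo| |hi|`. -/
theorem abs_clamp_le (lo hi s : ℝ) (h : lo < hi) : |max lo (min s hi)| ≤ max |lo| |hi| := by
  rcases le_total s hi with hs | hs
  · rw [min_eq_left hs]
    rcases le_total lo s with hl | hl
    · rw [max_eq_right hl]
      rw [abs_le]
      constructor
      · have : -max |lo| |hi| ≤ -|lo| := by
          have := le_max_left |lo| |hi|; linarith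
        have h2 : -|lo| ≤ lo := neg_abs_le lo
        linarith
      · exact le_trans (le_trans hs (le_abs_self hi)) (le_max_right _ _)
    · rw [max_eq_left hl]
      exact le_trans (le_refl _) (le_max_left _ _)
  · rw [min_eq_right hs, max_eq_right (le_of_lt h)]
    exact le_max_right _ _

/-- Hence the clamped `Hs` is bounded by `ρ · max |lo| |hi|` on the guard-on branch (and is `0` off it). -/
theorem abs_clampedHs_le (lo hi : ℝ) (h : lo < hi) (f : ℝ → ℝ) (σ a b : ℝ) :
    |(if 0 < a ∧ 0 < b then -(a * max lo (min (3 / 2 * Real.log b - Real.log a - f (a * σ ^ 3)) hi)) else 0)|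
      ≤ |a| * max |lo| |hi| := by
  split_ifs with hab
  · rw [abs_neg, abs_mul]
    exact mul_le_mul_of_nonneg_left (abs_clamp_le lo hi _ h) (abs_nonneg a)
  · simp only [abs_zero]
    positivity

end Summit.AtomisticToContinuum.HydrodynamicLimit.Cruxes.LocalSecondLaw.StrategyCensusP1
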